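import Mathlib
import Summits.ABC.ABC.Statement
import HarnessLib
import Literature.Uncategorized.Cohen2007Thm1534

/-!
# The square slices of the generic ω = 3 equations, from Bennett–Skinner–Ivorra–Siksek (solo-blind seat, session 5)

The (p,p,2) line of the ω = 3 atlas: the generic equations `2^l + q^m = rⁿ` (shape A) and `p^l + q^m = 2ⁿ` (shape B) with ONE
odd-base exponent equal to `2` and the other divisible by a prime `≥ 7` are proper solutions of `x² = y^p + 2^r z^p`, `r ≥ 2`,
which is completely solved in print (Bennett–Skinner 2004, Ivorra 2003, Siksek; as stated in H. Cohen, *Number Theory II*,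
Thm 15.3.4: the only nonzero pairwise coprime solutions for `r ≥ 2`, `p ≥ 7` have `r = 3`, `(x, y, z) = (±3, 1, 1)`).  We record
that printed theorem as a named fact (hypothesis) and deduce that the three square slices are EMPTY:

* `shapeA_sq_right_slice` : `2^l + q^m = r²`, `l ≥ 2`, `q > 1`, `m ≠ 0`, `7 ≤ p ∣ m` ⇒ `False`;
* `shapeA_sq_left_slice`  : `2^l + q² = rⁿ`, `l ≥ 2`, `n ≠ 0`, `7 ≤ p ∣ n` ⇒ `False`;
* `shapeB_sq_slice`        : `p² + q^m = 2ⁿ`, `n ≥ 2`, `m ≠ 0`, `7 ≤ P ∣ m` ⇒ `False`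
(odd coprime bases throughout).  The excluded boundary cases are genuine: `l = 1` is `x² - 2 = y^p` (open), `m = 0` is `8 + 1 = 9`,
and exponents `3, 5` carry `2 + 5² = 3³`, `2⁷ + 17³ = 71²`, `13² + 7³ = 2⁹`.
-/

namespace Summit.ABC.ABC.Theorems

/-- Powers of coprime naturals are coprime integers. -/
private theorem isCoprime_pow_cast {a b : ℕ} (h : Nat.Coprime a b) (i j : ℕ) :
    IsCoprime ((a : ℤ) ^ i) ((b : ℤ) ^ j) :=
  (Nat.isCoprime_iff_coprime.mpr h).pow

/-- **Shape A, square on the right.** `2^l + q^m = r²` with `q, r` coprime, `q > 1`, `l ≥ 2`, `m ≠ 0` and `m` divisible by a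
prime `p ≥ 7` is impossible (given Thm 15.3.4). -/
theorem shapeA_sq_right_slice (hC : Literature.Uncategorized.cohen2007_thm_15_3_4) {l m q r p : ℕ} (hcop : Nat.Coprime q r) (hq1 : 1 < q)
    (hl : 2 ≤ l) (hm : m ≠ 0) (hp : p.Prime) (hp7 : 7 ≤ p) (hpm : p ∣ m) (h : 2 ^ l + q ^ m = r ^ 2) : False := by
  obtain ⟨k, rfl⟩ := hpm
  have hk : 1 ≤ k := Nat.one_le_iff_ne_zero.mpr (by rintro rfl; exact hm (mul_zero p))
  rw [pow_mul'] at h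
  have hY1 : (1 : ℤ) < ((q : ℤ) ^ k) := by exact_mod_cast Nat.one_lt_pow (by omega) hq1
  have hr0 : (r : ℤ) ≠ 0 := by
    have : 1 ≤ r ^ 2 := by have := Nat.one_le_two_pow (n := l); omega
    have : r ≠ 0 := by rintro rfl; simp at this
    exact_mod_cast this
  have hnz : (r : ℤ) * ((q : ℤ) ^ k) * 1 ≠ 0 := by
    rw [mul_one]; exact mul_ne_zero hr0 (by positivity)
  have c1 : IsCoprime (r : ℤ) ((q : ℤ) ^ k) := by
    have := isCoprime_pow_cast hcop.symm 1 k
    rwa [pow_one] at this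
  have hEq : (r : ℤ) ^ 2 = ((q : ℤ) ^ k) ^ p + 2 ^ l * 1 ^ p := by
    rw [one_pow, mul_one]
    exact_mod_cast (by rw [← h]; ring : r ^ 2 = (q ^ k) ^ p + 2 ^ l)
  obtain ⟨-, -, hy, -⟩ := hC p hp hp7 l hl (r : ℤ) ((q : ℤ) ^ k) 1 hnz c1 isCoprime_one_right isCoprime_one_right hEq
  linarith

/-- **Shape A, square on the left.** `2^l + q² = rⁿ` with `q, r` coprime, `l ≥ 2`, `n ≠ 0` and `n` divisible by a prime `p ≥ 7`
is impossible (given Thm 15.3.4). -/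
theorem shapeA_sq_left_slice (hC : Literature.Uncategorized.cohen2007_thm_15_3_4) {l n q r p : ℕ} (hcop : Nat.Coprime q r) (hl : 2 ≤ l)
    (hn : n ≠ 0) (hp : p.Prime) (hp7 : 7 ≤ p) (hpn : p ∣ n) (h : 2 ^ l + q ^ 2 = r ^ n) : False := by
  obtain ⟨k, rfl⟩ := hpn
  have hk : 1 ≤ k := Nat.one_le_iff_ne_zero.mpr (by rintro rfl; exact hn (mul_zero p))
  rw [pow_mul'] at h
  have hpodd : Odd p := hp.odd_of_ne_two (by omega)
  have hq0 : (q : ℤ) ≠ 0 := by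
    have hq : q ≠ 0 := by
      rintro rfl
      rw [zero_pow two_ne_zero, add_zero] at h
      -- `2^l = (r^k)^p` with `p ≥ 7` odd… and also `q = 0` is not coprime to `r` unless `r = 1`: use coprimality
      have : r = 1 := by simpa using hcop
      rw [this, one_pow, one_pow] at h
      have : 4 ≤ 2 ^ l := by
        calc 4 = 2 ^ 2 := by norm_num
          _ ≤ 2 ^ l := Nat.pow_le_pow_right (by norm_num) hl
      omega
    exact_mod_cast hq
  have hX0 : ((r : ℤ) ^ k) ≠ 0 := by
    have : r ≠ 0 := by
      rintro rfl
      rw [zero_pow (by omega), zero_pow hp.ne_zero] at h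
      have := Nat.one_le_two_pow (n := l); omega
    exact pow_ne_zero _ (by exact_mod_cast this)
  have hnz : (q : ℤ) * ((r : ℤ) ^ k) * (-1) ≠ 0 := by
    rw [mul_neg_one, neg_ne_zero]; exact mul_ne_zero hq0 hX0
  have c1 : IsCoprime (q : ℤ) ((r : ℤ) ^ k) := by
    have := isCoprime_pow_cast hcop 1 k
    rwa [pow_one] at this
  have hEq : (q : ℤ) ^ 2 = ((r : ℤ) ^ k) ^ p + 2 ^ l * (-1) ^ p := by
    rw [hpodd.neg_one_pow, mul_neg_one]
    have : ((2 ^ l + q ^ 2 : ℕ) : ℤ) = (((r ^ k) ^ p : ℕ) : ℤ) := by rw [h]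
    push_cast at this
    linarith
  obtain ⟨-, -, -, hz⟩ := hC p hp hp7 l hl (q : ℤ) ((r : ℤ) ^ k) (-1) hnz c1 (isCoprime_one_right.neg_right)
    (isCoprime_one_right.neg_right) hEq
  norm_num at hz

/-- **Shape B, a square.** `p² + q^m = 2ⁿ` with `p, q` coprime, `n ≥ 2`, `m ≠ 0` and `m` divisible by a prime `P ≥ 7` is
impossible (given Thm 15.3.4). -/
theorem shapeB_sq_slice (hC : Literature.Uncategorized.cohen2007_thm_15_3_4) {m n p q P : ℕ} (hcop : Nat.Coprime p q) (hn : 2 ≤ n) (hm : m ≠ 0)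
    (hP : P.Prime) (hP7 : 7 ≤ P) (hPm : P ∣ m) (h : p ^ 2 + q ^ m = 2 ^ n) : False := by
  obtain ⟨k, rfl⟩ := hPm
  have hk : 1 ≤ k := Nat.one_le_iff_ne_zero.mpr (by rintro rfl; exact hm (mul_zero P))
  rw [pow_mul'] at h
  have hPodd : Odd P := hP.odd_of_ne_two (by omega)
  -- `p` and `q` are odd: if one were even the other is too (the sum is `≡ 0 mod 4`), contradicting coprimality
  have h4 : 4 ∣ 2 ^ n := by
    calc (4 : ℕ) = 2 ^ 2 := by norm_num
      _ ∣ 2 ^ n := Nat.pow_dvd_pow 2 hn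
  have hp0 : p ≠ 0 := by
    rintro rfl
    have hq1 : q = 1 := by simpa using hcop
    rw [hq1, one_pow, one_pow, zero_pow two_ne_zero, zero_add] at h
    rw [← h] at h4
    omega
  have hq0 : q ≠ 0 := by
    rintro rfl
    have hp1 : p = 1 := by simpa using hcop
    rw [hp1, one_pow, zero_pow (by omega), zero_pow hP.ne_zero, add_zero] at h
    rw [← h] at h4
    omega
  have hnz : (p : ℤ) * (-((q : ℤ) ^ k)) * 1 ≠ 0 := by
    rw [mul_one, mul_neg, neg_ne_zero]
    exact mul_ne_zero (by exact_mod_cast hp0) (pow_ne_zero _ (by exact_mod_cast hq0))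
  have c1 : IsCoprime (p : ℤ) (-((q : ℤ) ^ k)) := by
    have := isCoprime_pow_cast hcop 1 k
    rw [pow_one] at this
    exact this.neg_right
  have hEq : (p : ℤ) ^ 2 = (-((q : ℤ) ^ k)) ^ P + 2 ^ n * 1 ^ P := by
    rw [hPodd.neg_pow, one_pow, mul_one]
    have : ((p ^ 2 + (q ^ k) ^ P : ℕ) : ℤ) = ((2 ^ n : ℕ) : ℤ) := by rw [h]
    push_cast at this
    linarith
  obtain ⟨-, -, hy, -⟩ := hC P hP hP7 n hn (p : ℤ) (-((q : ℤ) ^ k)) 1 hnz c1 isCoprime_one_right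
    (isCoprime_one_right) hEq
  have : (0 : ℤ) ≤ ((q : ℤ) ^ k) := by positivity
  linarith

end Summit.ABC.ABC.Theorems
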